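import Literature.AlgebraicGeometry.Resolution.InseparableLocalUniformizationLemmas
import Mathlib.RingTheory.DedekindDomain.AdicValuation
import Mathlib.FieldTheory.RatFunc.AsPolynomial
import Mathlib.RingTheory.Flat.TorsionFree
import Mathlib.Algebra.Field.ULift
import HarnessLib

/-!
# Smooth-equivalence and normalization in a purely inseparable extension (Temkin 2013, Lemma 2.8.5): a correction

Topic: `Literature/AlgebraicGeometry/Resolution`. M. Temkin, *Inseparable local uniformization*,
J. Algebra 373 (2013) 65–119 = arXiv:0804.1554v3, Lemma 2.8.5 (p. 31): "Let `X → S` and `Y → S`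
be dominant morphisms between integral schemes and let `x ∈ X`, `y ∈ Y` be points which are
smooth-equivalent over `S`. Assume that `k′/k(S)` is a finite purely inseparable extension and
set `X′ = Nr_{k′k(X)}(X)` and `Y′ = Nr_{k′k(Y)}(Y)`. Then the preimages `x′ ∈ X′` and `y′ ∈ Y′`
of `x` and `y` are smooth-equivalent over `S`." Its printed proof: "The morphisms `X′ → X`,
`Y′ → Y` and `Z′ → Z` are bijective, hence we should only check that the induced morphisms
`f′ : Z′ → X′` and `Z′ → Y′` are smooth. But the latter was proved in Lemma 2.3.9(ii)."

**The printed statement tacitly assumes `X` and `Y` NORMAL** (as they are at every place where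
the lemma is applied in §4: `X_{i,α} = Nr_{Kᵢ}(X_α)`, `Y_{i,α} = Nr_{mᵢ}(Y_α)`, p. 49; `X`, `Y_m`
normalized models, p. 51): for a non-normal integral `X` the normalization `X′ → X` (case
`k′ = k(S)`) is not bijective, "the preimage `x′`" is not well defined, and the conclusion FAILS
for suitable preimages. The tree's rendering `Temkin2013_Lemma285`
(`InseparableLocalUniformizationLemmas.lean`), which faithfully quantifies over all primes `x′`,
`y′` of the integral closures lying over `x`, `y` and assumes only that `X = Spec A`, `Y = Spec B`
are integral, is therefore REFUTABLE. This file PROVES the refutation and vendors the corrected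
statement under a new name:

* `not_temkin2013_Lemma285 : ¬ Temkin2013_Lemma285` — PROVED. Counterexample (any field `F`,
  here `F = ULift ℚ` to reach every universe): `S = X = Y = Spec A` with
  `A = F[X² - X, X³ - X²] = F + (X² - X)F[X] ⊂ F(X)` (the affine line with the points `0` and `1`
  glued), `k′ = k(S) = F(X)` (the trivial purely inseparable extension), `x = y =` the singular
  point, smooth-equivalent to itself. The integral closure `C = Nr_{F(X)}(A)` (`= F[X]`) has the
  two primes `x′ = {v₀ < 1} ∋ X` and `y′ = {v₁ < 1} ∌ X` over `x` (`v_a` the `(X - a)`-adic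
  valuation). If `x′`, `y′` were smooth-equivalent over `S = Spec A` via `Z = Spec D`, the two
  structure maps `φ₁, φ₂ : C → D` would agree on `A`, hence on `u = X² - X` and `w = X³ - X² = Xu`;
  as `φ₁(u)` is a non-zero-divisor on the flat (smooth) `C`-algebra `D`, `φ₁(X) = φ₂(X)`; but
  `φ₁(X) ∈ z` (as `X ∈ x′ = φ₁⁻¹(z)`) while `φ₂(X) ∉ z` (as `X ∉ y′ = φ₂⁻¹(z)`).
* `Temkin2013_Lemma285_normal` — NAMED FACT, the corrected rendering: the same statement with
  `X = Spec A` and `Y = Spec B` NORMAL (`IsIntegrallyClosed A`, `IsIntegrallyClosed B`). Then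
  `X′ → X` and `Y′ → Y` are bijective (integral and radicial) and the printed proof applies
  (given Lemma 2.3.9 (i)–(ii), which rest on "smooth over normal is normal", [LMB, 16.2.1]);
  not reproduced here.

## Sources

* M. Temkin, *Inseparable local uniformization*, arXiv:0804.1554v3, Lemma 2.8.5 and its proof
  (p. 31); Lemma 2.3.9 (pp. 15–16); applications: proof of Thm. 4.1.1, Step 4 (p. 49), §4.2,
  Step 2 (p. 51).
-/

noncomputable section

open Polynomial IsDedekindDomain

namespace Literature.AlgebraicGeometry.Resolution

universe u

/-! ### The counterexample: the affine line with two points glued -/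

namespace Lemma285Counterexample

variable (F : Type u) [Field F]

/-- The coordinate ring `A = F[X² - X, X³ - X²] ⊂ F(X)` of the affine line over `F` with the
points `X = 0` and `X = 1` identified (the functions `f ∈ F[X]` with `f(0) = f(1)`), as an
`F`-subalgebra of the rational function field. [folklore] -/
def nodeAlg : Subalgebra F (RatFunc F) :=
  Algebra.adjoin F {(RatFunc.X : RatFunc F) ^ 2 - RatFunc.X,
    (RatFunc.X : RatFunc F) ^ 3 - RatFunc.X ^ 2}

/-- The place `X = a` of `F(X)`: the height-one prime `(X - a)` of `F[X]`. [folklore] -/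
def placeAt (a : F) : HeightOneSpectrum F[X] where
  asIdeal := Ideal.span {X - C a}
  isPrime := (Ideal.span_singleton_prime (X_sub_C_ne_zero a)).mpr (prime_X_sub_C a)
  ne_bot := by
    rw [Ne, Ideal.span_singleton_eq_bot]
    exact X_sub_C_ne_zero a

/-- `u = X² - X` is the image of the polynomial `X² - X`. [folklore] -/
theorem u_eq : (RatFunc.X : RatFunc F) ^ 2 - RatFunc.X =
    algebraMap F[X] (RatFunc F) (X ^ 2 - X) := by
  simp [map_sub, map_pow, RatFunc.algebraMap_X]

/-- `w = X³ - X²` is the image of the polynomial `X³ - X²`. [folklore] -/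
theorem w_eq : (RatFunc.X : RatFunc F) ^ 3 - RatFunc.X ^ 2 =
    algebraMap F[X] (RatFunc F) (X ^ 3 - X ^ 2) := by
  simp [map_sub, map_pow, RatFunc.algebraMap_X]

/-- `u ∈ A`. [folklore] -/
theorem u_mem : (RatFunc.X : RatFunc F) ^ 2 - RatFunc.X ∈ nodeAlg F :=
  Algebra.subset_adjoin (Set.mem_insert _ _)

/-- `w ∈ A`. [folklore] -/
theorem w_mem : (RatFunc.X : RatFunc F) ^ 3 - RatFunc.X ^ 2 ∈ nodeAlg F :=
  Algebra.subset_adjoin (Set.mem_insert_of_mem _ (Set.mem_singleton _))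

/-- `X² - X = X(X - 1) ≠ 0` in `F[X]`. [folklore] -/
theorem X_sq_sub_X_ne_zero : (X ^ 2 - X : F[X]) ≠ 0 := by
  have : (X ^ 2 - X : F[X]) = X * (X - C 1) := by
    rw [map_one]
    ring
  rw [this]
  exact mul_ne_zero X_ne_zero (X_sub_C_ne_zero 1)

/-- `u ≠ 0` in `F(X)`. [folklore] -/
theorem u_ne_zero : (RatFunc.X : RatFunc F) ^ 2 - RatFunc.X ≠ 0 := by
  rw [u_eq, Ne, map_eq_zero_iff _ (IsFractionRing.injective F[X] (RatFunc F))]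
  exact X_sq_sub_X_ne_zero F

/-- `Xⁿ·(X² - X) ∈ A` for all `n` (from `X² = X + u`: `X^{n+2}u = X^{n+1}u + Xⁿu·u`). [folklore] -/
theorem X_pow_mul_u_mem (n : ℕ) :
    (RatFunc.X : RatFunc F) ^ n * (RatFunc.X ^ 2 - RatFunc.X) ∈ nodeAlg F := by
  induction n using Nat.twoStepInduction with
  | zero => simpa using u_mem F
  | one =>
    have : (RatFunc.X : RatFunc F) ^ 1 * (RatFunc.X ^ 2 - RatFunc.X) =
        RatFunc.X ^ 3 - RatFunc.X ^ 2 := by ring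
    rw [this]
    exact w_mem F
  | more n h0 h1 =>
    have : (RatFunc.X : RatFunc F) ^ (n + 2) * (RatFunc.X ^ 2 - RatFunc.X) =
        RatFunc.X ^ (n + 1) * (RatFunc.X ^ 2 - RatFunc.X) +
          RatFunc.X ^ n * (RatFunc.X ^ 2 - RatFunc.X) * (RatFunc.X ^ 2 - RatFunc.X) := by
      ring
    rw [this]
    exact add_mem h1 (mul_mem h0 (u_mem F))

/-- Every polynomial multiple of `X² - X` lies in `A`. [folklore] -/
theorem algebraMap_mul_mem (p : F[X]) :
    algebraMap F[X] (RatFunc F) (p * (X ^ 2 - X)) ∈ nodeAlg F := by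
  rw [p.as_sum_range_C_mul_X_pow, Finset.sum_mul, map_sum]
  refine Subalgebra.sum_mem _ fun i _ => ?_
  have : algebraMap F[X] (RatFunc F) (C (p.coeff i) * X ^ i * (X ^ 2 - X)) =
      p.coeff i • ((RatFunc.X : RatFunc F) ^ i * (RatFunc.X ^ 2 - RatFunc.X)) := by
    rw [Algebra.smul_def, IsScalarTower.algebraMap_apply F F[X] (RatFunc F),
      Polynomial.algebraMap_apply, map_mul, map_mul, u_eq, map_pow, RatFunc.algebraMap_X]
    simp [mul_assoc]
  rw [this]
  exact Subalgebra.smul_mem _ (X_pow_mul_u_mem F i) _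

/-- `A → F(X)` is injective. [folklore] -/
instance : FaithfulSMul (nodeAlg F) (RatFunc F) :=
  (faithfulSMul_iff_algebraMap_injective _ _).mpr Subtype.val_injective

/-- `F(X)` is the fraction field of `A` (`p/q = (p u)/(q u)` with `u = X² - X`). [folklore] -/
theorem isFractionRing_nodeAlg : IsFractionRing (nodeAlg F) (RatFunc F) := by
  refine IsFractionRing.of_field _ _ fun z => ?_
  refine ⟨⟨_, algebraMap_mul_mem F z.num⟩, ⟨_, algebraMap_mul_mem F z.denom⟩, ?_⟩
  change z = algebraMap F[X] (RatFunc F) (z.num * (X ^ 2 - X)) /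
    algebraMap F[X] (RatFunc F) (z.denom * (X ^ 2 - X))
  rw [map_mul, map_mul, ← u_eq, mul_div_mul_right _ _ (u_ne_zero F), RatFunc.num_div_denom]

/-- The elements of `A` are the `c + (X² - X)·g`, `c ∈ F`, `g ∈ F[X]`. [folklore] -/
theorem exists_eq_of_mem_nodeAlg {z : RatFunc F} (hz : z ∈ nodeAlg F) :
    ∃ (c : F) (g : F[X]), z = algebraMap F[X] (RatFunc F) (C c + (X ^ 2 - X) * g) := by
  induction hz using Algebra.adjoin_induction with
  | mem x hx =>
    rcases hx with rfl | rfl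
    · exact ⟨0, 1, by rw [u_eq]; simp⟩
    · refine ⟨0, X, ?_⟩
      rw [w_eq, map_zero, zero_add]
      congr 1
      ring
  | algebraMap c =>
    refine ⟨c, 0, ?_⟩
    rw [mul_zero, add_zero, IsScalarTower.algebraMap_apply F F[X] (RatFunc F),
      Polynomial.algebraMap_eq]
  | add x y _ _ hx hy =>
    obtain ⟨c₁, g₁, rfl⟩ := hx
    obtain ⟨c₂, g₂, rfl⟩ := hy
    refine ⟨c₁ + c₂, g₁ + g₂, ?_⟩
    rw [← map_add]
    congr 1
    rw [map_add]
    ring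
  | mul x y _ _ hx hy =>
    obtain ⟨c₁, g₁, rfl⟩ := hx
    obtain ⟨c₂, g₂, rfl⟩ := hy
    refine ⟨c₁ * c₂, C c₁ * g₂ + C c₂ * g₁ + (X ^ 2 - X) * g₁ * g₂, ?_⟩
    rw [← map_mul]
    congr 1
    rw [map_mul]
    ring

/-- The `(X - a)`-adic valuation of a polynomial is `< 1` iff `a` is a root. [folklore] -/
theorem valuation_algebraMap_lt_one_iff (a : F) (p : F[X]) :
    (placeAt F a).valuation (RatFunc F) (algebraMap F[X] (RatFunc F) p) < 1 ↔ p.IsRoot a := by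
  rw [HeightOneSpectrum.valuation_lt_one_iff_mem]
  change p ∈ Ideal.span {X - C a} ↔ _
  rw [Ideal.mem_span_singleton, dvd_iff_isRoot]

/-- The `(X - a)`-adic valuation of a polynomial is `≤ 1`. [folklore] -/
theorem valuation_algebraMap_le_one (a : F) (p : F[X]) :
    (placeAt F a).valuation (RatFunc F) (algebraMap F[X] (RatFunc F) p) ≤ 1 :=
  HeightOneSpectrum.valuation_le_one _ _

/-- On `A` the places `X = 0` and `X = 1` have the same centre: for `z = c + (X² - X)g` both
`v₀(z) < 1` and `v₁(z) < 1` mean `c = 0`. [folklore] -/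
theorem valuation_lt_one_iff_of_mem {z : RatFunc F} (hz : z ∈ nodeAlg F) (a : F)
    (ha : a = 0 ∨ a = 1) :
    (placeAt F a).valuation (RatFunc F) z < 1 ↔
      ∃ g : F[X], z = algebraMap F[X] (RatFunc F) ((X ^ 2 - X) * g) := by
  obtain ⟨c, g, rfl⟩ := exists_eq_of_mem_nodeAlg F hz
  have haa : a ^ 2 - a = 0 := by
    rcases ha with rfl | rfl <;> ring
  rw [valuation_algebraMap_lt_one_iff]
  constructor
  · intro h
    have hc : c = 0 := by
      have : Polynomial.eval a (C c + (X ^ 2 - X) * g) = 0 := h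
      simp only [eval_add, eval_C, eval_mul, eval_sub, eval_pow, eval_X] at this
      rwa [haa, zero_mul, add_zero] at this
    exact ⟨g, by rw [hc, map_zero, zero_add]⟩
  · rintro ⟨g', hg'⟩
    rw [(IsFractionRing.injective F[X] (RatFunc F)) hg']
    change Polynomial.eval a ((X ^ 2 - X) * g') = 0
    simp only [eval_mul, eval_sub, eval_pow, eval_X]
    rw [haa, zero_mul]

/-- `X` is integral over `A`: it is a root of `T² - T - (X² - X)`. [folklore] -/
theorem isIntegral_X : IsIntegral (nodeAlg F) (RatFunc.X : RatFunc F) := by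
  refine ⟨X ^ 2 - (X + C ⟨RatFunc.X ^ 2 - RatFunc.X, u_mem F⟩), ?_, ?_⟩
  · refine (monic_X_pow 2).sub_of_left ?_
    refine lt_of_le_of_lt (degree_add_le _ _) ?_
    rw [degree_X_pow, max_lt_iff]
    refine ⟨by rw [degree_X]; exact_mod_cast Nat.lt_succ_self 1, lt_of_le_of_lt degree_C_le ?_⟩
    exact_mod_cast Nat.zero_lt_succ 1
  · simp only [eval₂_sub, eval₂_add, eval₂_X_pow, eval₂_X, eval₂_C]
    change (RatFunc.X : RatFunc F) ^ 2 - (RatFunc.X + (RatFunc.X ^ 2 - RatFunc.X)) = 0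
    ring

/-- Elements integral over `A` have `(X - a)`-adic value `≤ 1` (the valuation ring is integrally
closed and contains `A`). [folklore] -/
theorem valuation_le_one_of_isIntegral (a : F) {z : RatFunc F} (hz : IsIntegral (nodeAlg F) z) :
    (placeAt F a).valuation (RatFunc F) z ≤ 1 := by
  set v := (placeAt F a).valuation (RatFunc F) with hv
  set O := v.valuationSubring with hO
  have hAO : ∀ y ∈ nodeAlg F, y ∈ O := by
    intro y hy
    obtain ⟨c, g, rfl⟩ := exists_eq_of_mem_nodeAlg F hy
    exact (Valuation.mem_valuationSubring_iff _ _).mpr (valuation_algebraMap_le_one F a _)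
  letI : Algebra (nodeAlg F) O :=
    ((Subalgebra.val (nodeAlg F)).toRingHom.codRestrict O.toSubring fun y => hAO y y.2).toAlgebra
  haveI : IsScalarTower (nodeAlg F) O (RatFunc F) := IsScalarTower.of_algebraMap_eq fun _ => rfl
  have hz' : IsIntegral O z := hz.tower_top
  obtain ⟨y, rfl⟩ := IsIntegrallyClosed.algebraMap_eq_of_integral hz'
  exact (Valuation.mem_valuationSubring_iff _ _).mp y.2

/-- The ring map `C = Nr_{F(X)}(A) → (F(X))°_{v_a}` (inclusion into the valuation ring).
[folklore] -/
def toPlace (a : F) :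
    integralClosure (nodeAlg F) (RatFunc F) →+*
      ((placeAt F a).valuation (RatFunc F)).valuationSubring :=
  (algebraMap (integralClosure (nodeAlg F) (RatFunc F)) (RatFunc F)).codRestrict _ fun c =>
    (Valuation.mem_valuationSubring_iff _ _).mpr (valuation_le_one_of_isIntegral F a c.2)

/-- The prime `{v_a < 1}` of `C = Nr_{F(X)}(A)`: the centre of the place `X = a` on `Spec C`.
[folklore] -/
def primeAt (a : F) : Ideal (integralClosure (nodeAlg F) (RatFunc F)) :=
  (IsLocalRing.maximalIdeal _).comap (toPlace F a)

/-- The centre of a place is a prime ideal. [folklore] -/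
instance (a : F) : (primeAt F a).IsPrime := Ideal.comap_isPrime _ _

/-- Membership in the centre of the place `X = a` is `v_a < 1`. [folklore] -/
theorem mem_primeAt_iff (a : F) (c : integralClosure (nodeAlg F) (RatFunc F)) :
    c ∈ primeAt F a ↔ (placeAt F a).valuation (RatFunc F) (c : RatFunc F) < 1 := by
  rw [primeAt, Ideal.mem_comap, ValuationSubring.valuation_lt_one_iff,
    ← (Valuation.isEquiv_valuation_valuationSubring _).lt_one_iff_lt_one]
  rfl

/-- The two centres agree on `A`: `x′ ∩ A = y′ ∩ A`. [folklore] -/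
theorem comap_primeAt_zero_eq_one :
    (primeAt F 0).comap (algebraMap (nodeAlg F) (integralClosure (nodeAlg F) (RatFunc F))) =
      (primeAt F 1).comap (algebraMap (nodeAlg F) (integralClosure (nodeAlg F) (RatFunc F))) := by
  ext z
  rw [Ideal.mem_comap, Ideal.mem_comap, mem_primeAt_iff, mem_primeAt_iff]
  change (placeAt F 0).valuation (RatFunc F) (z : RatFunc F) < 1 ↔
    (placeAt F 1).valuation (RatFunc F) (z : RatFunc F) < 1
  rw [valuation_lt_one_iff_of_mem F z.2 0 (Or.inl rfl), valuation_lt_one_iff_of_mem F z.2 1 (Or.inr rfl)]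

/-- `X ∈ x′` (the place `X = 0`) … [folklore] -/
theorem X_mem_primeAt_zero :
    (⟨RatFunc.X, isIntegral_X F⟩ : integralClosure (nodeAlg F) (RatFunc F)) ∈ primeAt F 0 := by
  rw [mem_primeAt_iff]
  change (placeAt F 0).valuation (RatFunc F) (RatFunc.X : RatFunc F) < 1
  rw [← RatFunc.algebraMap_X, valuation_algebraMap_lt_one_iff]
  simp

/-- … but `X ∉ y′` (the place `X = 1`). [folklore] -/
theorem X_not_mem_primeAt_one :
    (⟨RatFunc.X, isIntegral_X F⟩ : integralClosure (nodeAlg F) (RatFunc F)) ∉ primeAt F 1 := by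
  rw [mem_primeAt_iff]
  change ¬ (placeAt F 1).valuation (RatFunc F) (RatFunc.X : RatFunc F) < 1
  rw [← RatFunc.algebraMap_X, valuation_algebraMap_lt_one_iff]
  simp

-- `Temkin2013_Lemma285` is `@[deprecated]` (mis-rendered, refuted here; 2026-08-15) and its refutation must name it;
-- REMOVE-WHEN the deprecated def is deleted from `InseparableLocalUniformizationLemmas.lean`.
set_option linter.deprecated false in
include F in
/-- The counterexample: `Temkin2013_Lemma285` fails for `S = X = Y = Spec A`, `k′ = k(S)`,
`x = y` the glued point and the two preimages `x′ ≠ y′` in `Spec Nr(A)`. [folklore] -/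
theorem not_lemma285_aux (h : Temkin2013_Lemma285.{u}) : False := by
  classical
  haveI : IsFractionRing (nodeAlg F) (RatFunc F) := isFractionRing_nodeAlg F
  haveI : FaithfulSMul (nodeAlg F) (nodeAlg F) := ⟨fun {a b} hab => by simpa using hab 1⟩
  set C := integralClosure (nodeAlg F) (RatFunc F) with hC
  set x : Ideal (nodeAlg F) := (primeAt F 0).comap (algebraMap (nodeAlg F) C) with hx
  haveI hxp : x.IsPrime := Ideal.comap_isPrime _ _
  have hy : (primeAt F 1).comap (algebraMap (nodeAlg F) C) = x :=
    (comap_primeAt_zero_eq_one F).symm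
  have hadj : Algebra.adjoin (RatFunc F) (Set.range (algebraMap (RatFunc F) (RatFunc F))) = ⊤ := by
    have : Set.range (algebraMap (RatFunc F) (RatFunc F)) = Set.univ :=
      Set.range_eq_univ.mpr fun z => ⟨z, rfl⟩
    rw [this, Algebra.adjoin_univ]
  have key := h (nodeAlg F) (RatFunc F) (RatFunc F) inferInstance inferInstance
    (nodeAlg F) (RatFunc F) (RatFunc F) hadj (nodeAlg F) (RatFunc F) (RatFunc F) hadj
    x x hxp hxp (AreSmoothEquivalent.refl _ x) (primeAt F 0) (primeAt F 1) inferInstance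
    inferInstance rfl hy
  obtain ⟨D, _, i₁, i₂, hcomp, hs₁, hs₂, r, hr, hr₁, hr₂⟩ := key
  -- the two structure maps
  set φ₁ : C →+* D := @algebraMap C D _ _ i₁ with hφ₁
  set φ₂ : C →+* D := @algebraMap C D _ _ i₂ with hφ₂
  have hr₁' : r.comap φ₁ = primeAt F 0 := hr₁
  have hr₂' : r.comap φ₂ = primeAt F 1 := hr₂
  have hagree : ∀ a : nodeAlg F, φ₁ (algebraMap (nodeAlg F) C a) = φ₂ (algebraMap (nodeAlg F) C a) :=
    fun a => RingHom.congr_fun hcomp a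
  -- the elements `t = X`, `u = X² - X`, `w = X³ - X²`
  set t : C := ⟨RatFunc.X, isIntegral_X F⟩ with ht
  set uA : nodeAlg F := ⟨RatFunc.X ^ 2 - RatFunc.X, u_mem F⟩ with huA
  set wA : nodeAlg F := ⟨RatFunc.X ^ 3 - RatFunc.X ^ 2, w_mem F⟩ with hwA
  have htu : t * algebraMap (nodeAlg F) C uA = algebraMap (nodeAlg F) C wA := by
    apply Subtype.ext
    change (RatFunc.X : RatFunc F) * (RatFunc.X ^ 2 - RatFunc.X) = RatFunc.X ^ 3 - RatFunc.X ^ 2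
    ring
  have hu0 : algebraMap (nodeAlg F) C uA ≠ 0 := by
    intro h0
    have : ((algebraMap (nodeAlg F) C uA : C) : RatFunc F) = 0 := by rw [h0]; rfl
    exact u_ne_zero F this
  -- flatness of `D` over `C` via `φ₁`: `φ₁ u` is a non-zero-divisor on `D`
  have hflat : @Module.Flat C D _ _ i₁.toModule := @Algebra.Smooth.flat C D _ _ i₁ hs₁
  have hreg : @IsSMulRegular C D (@Algebra.toSMul C D _ _ i₁) (algebraMap (nodeAlg F) C uA) :=
    @Module.Flat.isSMulRegular_of_nonZeroDivisors C D _ _ i₁.toModule _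
      (mem_nonZeroDivisors_of_ne_zero hu0) hflat
  have hreg' : ∀ a b : D, φ₁ (algebraMap (nodeAlg F) C uA) * a =
      φ₁ (algebraMap (nodeAlg F) C uA) * b → a = b := by
    intro a b hab
    refine hreg ?_
    show @HSMul.hSMul C D D (@instHSMul C D (@Algebra.toSMul C D _ _ i₁))
        (algebraMap (nodeAlg F) C uA) a =
      @HSMul.hSMul C D D (@instHSMul C D (@Algebra.toSMul C D _ _ i₁))
        (algebraMap (nodeAlg F) C uA) b
    rw [@Algebra.smul_def C D _ _ i₁, @Algebra.smul_def C D _ _ i₁]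
    exact hab
  have heq : φ₁ t = φ₂ t := by
    have h1 : φ₁ t * φ₁ (algebraMap (nodeAlg F) C uA) = φ₁ (algebraMap (nodeAlg F) C wA) := by
      rw [← map_mul, htu]
    have h2 : φ₂ t * φ₂ (algebraMap (nodeAlg F) C uA) = φ₂ (algebraMap (nodeAlg F) C wA) := by
      rw [← map_mul, htu]
    rw [← hagree uA, ← hagree wA, ← h1] at h2
    -- `h2 : φ₂ t * φ₁ u = φ₁ t * φ₁ u`
    refine hreg' _ _ ?_
    rw [mul_comm (φ₁ _) (φ₁ t), mul_comm (φ₁ _) (φ₂ t)]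
    exact h2.symm
  -- `t ∈ x′ = φ₁⁻¹(r)` but `t ∉ y′ = φ₂⁻¹(r)`
  have h0 : t ∈ r.comap φ₁ := by
    rw [hr₁']
    exact X_mem_primeAt_zero F
  have h1 : t ∉ r.comap φ₂ := by
    rw [hr₂']
    exact X_not_mem_primeAt_one F
  rw [Ideal.mem_comap] at h0 h1
  rw [heq] at h0
  exact h1 h0

end Lemma285Counterexample

-- `Temkin2013_Lemma285` is `@[deprecated]` (mis-rendered, refuted here; 2026-08-15) and its refutation must name it;
-- REMOVE-WHEN the deprecated def is deleted from `InseparableLocalUniformizationLemmas.lean`.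
set_option linter.deprecated false in
/-- **`Temkin2013_Lemma285` (the tree's rendering of Temkin 2013, Lemma 2.8.5, for arbitrary
integral `X`, `Y` and all preimages `x′`, `y′`) is refutable** in every universe: take
`F = ULift ℚ` in `Lemma285Counterexample.not_lemma285_aux` (the affine line with two points
glued, `k′ = k(S)`). The printed lemma is used — and holds, by its printed proof — only for
NORMAL `X`, `Y`; the corrected rendering is `Temkin2013_Lemma285_normal`. [folklore] -/
theorem not_temkin2013_Lemma285 : ¬ Temkin2013_Lemma285.{u} := fun h =>
  Lemma285Counterexample.not_lemma285_aux (ULift.{u} ℚ) h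

/-- NAMED FACT — **purely inseparable normalized extension of the ground field preserves
smooth-equivalence, for NORMAL schemes** (Temkin 2013, Lemma 2.8.5, p. 31: "Let `X → S` and
`Y → S` be dominant morphisms between integral schemes and let `x ∈ X`, `y ∈ Y` be points which
are smooth-equivalent over `S`. Assume that `k′/k(S)` is a finite purely inseparable extension
and set `X′ = Nr_{k′k(X)}(X)` and `Y′ = Nr_{k′k(Y)}(Y)`. Then the preimages `x′ ∈ X′` and `y′ ∈ Y′`
of `x` and `y` are smooth-equivalent over `S`."), CORRECTED affine rendering. Discrepancy with
the source / with `Temkin2013_Lemma285`: the printed statement only assumes `X`, `Y` integral,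
but its proof ("`X′ → X`, `Y′ → Y` and `Z′ → Z` are bijective", and Lemma 2.3.9 (i)–(ii): a
scheme smooth over an integral NORMAL scheme is a disjoint union of integral normal schemes)
uses that `X` and `Y` are normal, and without normality the statement is false
(`not_temkin2013_Lemma285`: for the affine line with two points glued and `k′ = k(S)` the two
preimages of the singular point in the normalization are not smooth-equivalent over `S = X`).
In all applications (proof of Thm. 4.1.1, Step 4, p. 49: `X_{i,α} = Nr_{Kᵢ}(X_α)`,
`Y_{i,α} = Nr_{mᵢ}(Y_α)`; §4.2, Step 2, p. 51) `X` and `Y` are normal. Rendering: as in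
`Temkin2013_Lemma285` (`S = Spec R₀` with `R₀` a domain with fraction field `κ = k(S)`;
`X = Spec A`, `Y = Spec B` domains with fraction fields `K`, `M`, dominant over `S`; `k′ ⊇ κ`
finite purely inseparable; `K′ = k′K`, `M′ = k′M`; `X′ = Spec Nr_{K′}(A)`, `Y′ = Spec Nr_{M′}(B)`;
primes `x′`, `y′` over smooth-equivalent `x`, `y` are smooth-equivalent over `R₀`), plus the
hypotheses `IsIntegrallyClosed A`, `IsIntegrallyClosed B` (`X`, `Y` normal; then `X′ → X`,
`Y′ → Y` are integral and radicial, hence bijective, so `x′`, `y′` are "the preimages"). The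
printed proof rests on Lemma 2.3.9 (ii); not reproduced. Users take
`(h : Temkin2013_Lemma285_normal)`. [cite: Temkin2013, Lemma 2.8.5 (arXiv:0804.1554v3 p. 31)] -/
def Temkin2013_Lemma285_normal : Prop :=
  ∀ (R₀ κ k' : Type u) [CommRing R₀] [IsDomain R₀] [Field κ] [Algebra R₀ κ] [IsFractionRing R₀ κ]
    [Field k'] [Algebra κ k'] [Algebra R₀ k'] [IsScalarTower R₀ κ k'],
    FiniteDimensional κ k' → IsPurelyInseparable κ k' →
  ∀ (A K K' : Type u) [CommRing A] [IsDomain A] [IsIntegrallyClosed A] [Algebra R₀ A]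
    [FaithfulSMul R₀ A]
    [Field K] [Algebra A K] [IsFractionRing A K] [Algebra R₀ K] [IsScalarTower R₀ A K]
    [Field K'] [Algebra K K'] [Algebra A K'] [IsScalarTower A K K']
    [Algebra k' K'] [Algebra R₀ K'] [IsScalarTower R₀ K K'] [IsScalarTower R₀ k' K']
    [IsScalarTower R₀ A K'],
    Algebra.adjoin K (Set.range (algebraMap k' K')) = ⊤ →
  ∀ (B M M' : Type u) [CommRing B] [IsDomain B] [IsIntegrallyClosed B] [Algebra R₀ B]
    [FaithfulSMul R₀ B]
    [Field M] [Algebra B M] [IsFractionRing B M] [Algebra R₀ M] [IsScalarTower R₀ B M]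
    [Field M'] [Algebra M M'] [Algebra B M'] [IsScalarTower B M M']
    [Algebra k' M'] [Algebra R₀ M'] [IsScalarTower R₀ M M'] [IsScalarTower R₀ k' M']
    [IsScalarTower R₀ B M'],
    Algebra.adjoin M (Set.range (algebraMap k' M')) = ⊤ →
  ∀ (x : Ideal A) (y : Ideal B), x.IsPrime → y.IsPrime →
    AreSmoothEquivalent (algebraMap R₀ A) (algebraMap R₀ B) x y →
  ∀ (x' : Ideal (integralClosure A K')) (y' : Ideal (integralClosure B M')),
    x'.IsPrime → y'.IsPrime →
    x'.comap (algebraMap A (integralClosure A K')) = x →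
    y'.comap (algebraMap B (integralClosure B M')) = y →
    AreSmoothEquivalent (algebraMap R₀ (integralClosure A K')) (algebraMap R₀ (integralClosure B M'))
      x' y'

-- `Temkin2013_Lemma285` is `@[deprecated]` (mis-rendered, refuted here; 2026-08-15) and this record of the implication must name it;
-- REMOVE-WHEN the deprecated def is deleted from `InseparableLocalUniformizationLemmas.lean`.
set_option linter.deprecated false in
/-- The corrected fact is an instance of the (refutable) original rendering: it has the same
conclusion under additional hypotheses. [folklore] -/
theorem Temkin2013_Lemma285_normal.of_lemma285 (h : Temkin2013_Lemma285.{u}) :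
    Temkin2013_Lemma285_normal.{u} := by
  intro R₀ κ k' _ _ _ _ _ _ _ _ _ hfin hpi A K K' _ _ _ _ _ _ _ _ _ _ _ _ _ _ _ _ _ _ _ hK
    B M M' _ _ _ _ _ _ _ _ _ _ _ _ _ _ _ _ _ _ _ hM x y hx hy hxy x' y' hx' hy' hcx hcy
  exact h R₀ κ k' hfin hpi A K K' hK B M M' hM x y hx hy hxy x' y' hx' hy' hcx hcy

end Literature.AlgebraicGeometry.Resolution
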